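import Summits.ResolutionOfSingularities.ResolutionOfSingularities.Theorems.FrobeniusLadderFInjectiveMacaulayficationP3d4z4557NewtonKCoverRecords4
import Summits.ResolutionOfSingularities.ResolutionOfSingularities.Theorems.FrobeniusLadderFInjectiveMacaulayficationFanCheckChunks
import Mathlib.Tactic.IntervalCases
import HarnessLib

/-!
# HEAVY KERNEL CHECKS (cover records) of the BED W class-route certificate: the sparse multi-vertex cover records, ONE `decide +kernel` per block `j` of the product table
# (crux `FInjectiveMacaulayfication` stmt-ResolutionOfSingularities-15315, chain w45a; (W-WND) BED W class-route twin, res-L1-w45a-plan-1 R22.2 (1); seat res-L1-w45a-stub-3 g12)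

Support file for crux stmt-ResolutionOfSingularities-15315 (`FrobeniusLadder.FInjectiveMacaulayfication`), chain w45a.
[OURS · L1 W4.5a] — NOT a statement of any manuscript; AI-written, weaker than expert review.

`FanCheckChunks.checkHcovMultiL 5 (blockGens KL2 j) MV2 50 441 (RLMB j)` for `j = 0,…,4` (block `j` = the 2651 generators `b + e_j`, records `RLM2_j` of `P3d4z4557NewtonKCoverRecords0–4`,
kit job j319966), and the `∀ j < 5` form consumed by `FanCheckChunks.hcov_of_blocks`. No definitions, no named facts. [folklore]
-/

-- single-problem summit: the doubled namespace component is forced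
set_option linter.dupNamespace false

namespace Summit.ResolutionOfSingularities.ResolutionOfSingularities.Theorems.FInjectiveMacaulayfication.P3d4z4557NewtonKFan

open Summit.ResolutionOfSingularities.ResolutionOfSingularities.Theorems.FInjectiveMacaulayfication
open FanCheckKit FanCheckSound FanCheckChunks

/-- Cover records, block 0 (`b + e_0`). -/
theorem check_hcov_0 : checkHcovMultiL 5 (blockGens KL2 0) MV2 50 441 (RLMB 0) = true := by decide +kernel

/-- Cover records, block 1 (`b + e_1`). -/
theorem check_hcov_1 : checkHcovMultiL 5 (blockGens KL2 1) MV2 50 441 (RLMB 1) = true := by decide +kernel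

/-- Cover records, block 2 (`b + e_2`). -/
theorem check_hcov_2 : checkHcovMultiL 5 (blockGens KL2 2) MV2 50 441 (RLMB 2) = true := by decide +kernel

/-- Cover records, block 3 (`b + e_3`). -/
theorem check_hcov_3 : checkHcovMultiL 5 (blockGens KL2 3) MV2 50 441 (RLMB 3) = true := by decide +kernel

/-- Cover records, block 4 (`b + e_4`). -/
theorem check_hcov_4 : checkHcovMultiL 5 (blockGens KL2 4) MV2 50 441 (RLMB 4) = true := by decide +kernel

/-- ★ All five block checks, in the `∀ j < 5` shape of `FanCheckChunks.hcov_of_blocks`. -/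
theorem check_hcov : ∀ j < 5, checkHcovMultiL 5 (blockGens KL2 j) MV2 50 441 (RLMB j) = true := by
  intro j hj
  interval_cases j
  · exact check_hcov_0
  · exact check_hcov_1
  · exact check_hcov_2
  · exact check_hcov_3
  · exact check_hcov_4

end Summit.ResolutionOfSingularities.ResolutionOfSingularities.Theorems.FInjectiveMacaulayfication.P3d4z4557NewtonKFan
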